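import Mathlib
import Literature.Computability.AlgebraicComplexity.MultiplicityObstructionsProofs
import Literature.Computability.AlgebraicComplexity.OrbitClosureWeights
import Literature.Computability.AlgebraicComplexity.PlethysmLifting
import Literature.Computability.AlgebraicComplexity.GCTObstructions
import Literature.NumberTheory.DiophantineGeometry.SchurWeylPlethysmOrbitWeightsProofs
import Literature.NumberTheory.DiophantineGeometry.GLHighestWeightFacts
import Literature.Computability.Complexity.PlethysmStabilityBIP
import Summits.ValiantsHypothesis.ValiantsHypothesis.Theorems.ValuativeGCTValuativeFlipNoSmallBodyCoreGeneral
import Summits.ValiantsHypothesis.ValiantsHypothesis.Theorems.ValuativeGCTValuativeFlipLinearEntryPermanents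
import Summits.ValiantsHypothesis.ValiantsHypothesis.Theorems.ValuativeGCTValuativeFlipNoSmallBodyEquations

/-!
# NO SMALL-BODY EQUATIONS for the padded permanent: `mult_{λ*} ℂ[Δ_m(X₀₀^{m-n} per_n)] = a_λ(δ[m])` for `|λ̄| ≤ n`

Crux `ValuativeGCT.ValuativeFlip` (stmt-ValiantsHypothesis-12624), wall-breaker axis D
("det-orbit-closure multiplicity bounds for `detCensus`", seat k3 gen 1/2): the PER-SIDE instance of
the general no-small-body vanishing theorem `nsb_eq_zero_of_forall_body_le_of_testForms`
(`…NoSmallBodyCoreGeneral`), with body budget `B = n` supplied by the block permanents of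
`…LinearEntryPermanents` (`nsb_testForm_mem_orbitClosure_paddedPerFormLex`).

**Theorem (`paddedPer_orbitMultiplicity_eq_plethysmCoeff_of_bodySize_le_inner`).**  For `n ≤ m`,
`m ≥ 1`, every `δ` and every `λ ⊢ mδ` with at most `m²` parts and `bodySize λ = |λ̄| ≤ n`:

  `mult_{λ*} ℂ[Δ_m(X₀₀^{m-n} per_n)] = a_λ(δ[m])`  (`= K_m(λ*)`, `paddedPer_orbitMultiplicity_eq_det_of_bodySize_le_inner`),

i.e. the orbit closure of the padded permanent has NO equation of type `λ` at body `≤ n`, at every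
padding: on the tiny-body range the permanent side, the determinant side (k7 gen 1 seat 2's
`noSmallBodyEquations`, this seat's `nsb_eq_zero_of_forall_body_le`) and the plethysm coefficient all
coincide — exact per-side values for the census tables, and the first place where a per-side equation
can appear is body `n + 1`.  Weight bookkeeping (`nsb_body_eq_bodySize_of_mem_weightSpace`: a weight
vector of weight `λ*` has `δ` factors per monomial and body `|λ̄|`) and rank–nullity as in the det case.
No source states this; method new here (block-cyclic permanental test forms). [folklore tools:
BLMW 2011 §4.4–§5.2; Bürgisser–Ikenmeyer–Panova 2019 §5 (bodies); Kadish–Landsberg 2014]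
-/

-- `Summit.ValiantsHypothesis.ValiantsHypothesis.…` is the tree's mandated single-conjunct layout (Sub = Summit).
set_option linter.dupNamespace false

namespace Summit.ValiantsHypothesis.ValiantsHypothesis.Theorems.ValuativeFlip

open MvPolynomial
open Literature.NumberTheory.DiophantineGeometry Literature.Computability.AlgebraicComplexity
open Literature.Computability.Complexity
open scoped BigOperators

/-! ## Weight bookkeeping: monomials of a weight vector of weight `λ*` have `δ` factors and body `|λ̄|` -/

/-- The degree-`m` exponent vectors sum to `m`. [folklore] -/
theorem nsb_sum_degIdx_eq {m : ℕ} (d : DegIdx (MatIdx m) m) : ∑ i : MatIdx m, d.1 i = m := by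
  rw [← Finsupp.degree_eq_sum]
  exact mem_degMonomials_iff.mp d.2

/-- **Weight bookkeeping.**  For a torus weight vector `F ∈ ℂ[Sym^m ℂ^{m×m}]` of weight `λ*`
(`λ ⊢ mδ`, at most `m²` parts) every monomial `s` of `F` (a multiset of degree-`m` coefficient
indices) has exactly `δ` factors and body `Σ_d s(d) · (m - d(x_top)) = |λ̄| = bodySize λ`
(the variable `x_top` carries `λ₁`, all variables together carry `|λ| = mδ`). [folklore] -/
theorem nsb_body_eq_bodySize_of_mem_weightSpace {m δ : ℕ} [NeZero m] (lam : Nat.Partition (m * δ))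
    (hlam : lam.parts.card ≤ m * m) {F : MvPolynomial (DegIdx (MatIdx m) m) ℂ}
    (hF : F ∈ weightSpace (coordRep (MatIdx m) ℂ m) (partitionWeightLex m lam))
    {s : DegIdx (MatIdx m) m →₀ ℕ} (hs : s ∈ F.support) :
    s.degree = δ ∧ ∑ d ∈ s.support, s d * (m - d.1 (topMatIdx m)) = bodySize lam := by
  classical
  have hw := monWeight_eq_of_mem_weightSpace hF hs
  -- the top coordinate carries `λ₁`
  have htop : ∑ d ∈ s.support, s d * d.1 (topMatIdx m) = lam.parts.sup := by
    have h := congrFun hw (topMatIdx m)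
    rw [monWeight_apply] at h
    have h2 := neg_partitionWeightLex_revMatIdx m lam 0
    rw [revMatIdx_zero, Weight.ofPartition_apply, Fin.val_zero, ← sup_parts_eq_getD_sortedParts] at h2
    rw [← h, neg_neg] at h2
    exact_mod_cast h2
  -- all coordinates together carry `mδ`, and each factor has degree `m`
  have hsize : ∑ i : MatIdx m, partitionWeightLex m lam i = -((m * δ : ℕ) : ℤ) := by
    rw [← Equiv.sum_comp (revMatIdx m)]
    have h1 : ∀ i, partitionWeightLex m lam (revMatIdx m i) = -(Weight.ofPartition (m * m) lam i) :=
      fun i => by rw [← neg_partitionWeightLex_revMatIdx m lam i, neg_neg]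
    simp only [h1, Finset.sum_neg_distrib]
    rw [show ∑ i, Weight.ofPartition (m * m) lam i = (Weight.ofPartition (m * m) lam).size from rfl,
      Weight.size_ofPartition_holds hlam]
  have hmon : ∑ i : MatIdx m, monWeight s i = -((m * s.degree : ℕ) : ℤ) := by
    simp only [monWeight_apply, Finset.sum_neg_distrib]
    congr 1
    rw [← Nat.cast_sum]
    congr 1
    rw [Finset.sum_comm]
    have h1 : ∀ d ∈ s.support, ∑ i : MatIdx m, s d * d.1 i = s d * m := fun d _ => by
      rw [← Finset.mul_sum, nsb_sum_degIdx_eq]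
    rw [Finset.sum_congr rfl h1, ← Finset.sum_mul, Finsupp.degree_apply, mul_comm]
  have hdeg : s.degree = δ := by
    have h := hmon
    rw [hw, hsize, neg_inj, Nat.cast_inj] at h
    exact (Nat.eq_of_mul_eq_mul_left (Nat.pos_of_ne_zero (NeZero.ne m)) h).symm
  refine ⟨hdeg, ?_⟩
  -- the body
  have hle : ∀ d ∈ s.support, s d * d.1 (topMatIdx m) ≤ s d * m := fun d _ =>
    Nat.mul_le_mul_left _ ((Finsupp.le_degree _ _).trans (mem_degMonomials_iff.mp d.2).le)
  have h1 : ∑ d ∈ s.support, s d * (m - d.1 (topMatIdx m)) =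
      ∑ d ∈ s.support, (s d * m - s d * d.1 (topMatIdx m)) :=
    Finset.sum_congr rfl fun d _ => Nat.mul_sub _ _ _
  rw [h1, Finset.sum_tsub_distrib _ hle, htop, ← Finset.sum_mul, ← Finsupp.degree_apply, hdeg]
  have := sup_add_bodySize lam
  unfold bodySize
  rw [mul_comm δ m]

/-! ## The theorem -/

/-- **NO SMALL-BODY EQUATIONS for the padded permanent.**  For `n ≤ m` and `λ ⊢ mδ` with at most
`m²` parts and `bodySize λ ≤ n`:  `mult_{λ*} ℂ[Δ_m(X₀₀^{m-n} per_n)] = a_λ(δ[m])`.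
(`≤`: BLMW's plethysm bound; `≥`: a weight-`λ*` highest-weight vector has all monomials of body
`|λ̄| ≤ n`, and no such polynomial vanishes on `GL · X₀₀^{m-n} per_n`, whose orbit closure contains the
block-permanental test forms up to body `n` — `nsb_eq_zero_of_forall_body_le_of_testForms` with
`nsb_testForm_mem_orbitClosure_paddedPerFormLex`.) [folklore] -/
theorem paddedPer_orbitMultiplicity_eq_plethysmCoeff_of_bodySize_le_inner {n m δ : ℕ} [NeZero m]
    (hnm : n ≤ m) (lam : Nat.Partition (m * δ)) (hlam : lam.parts.card ≤ m * m) (hbody : bodySize lam ≤ n) :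
    orbitMultiplicity ℂ (paddedPerFormLex ℂ n m) m (partitionWeightLex m lam) =
      plethysmCoeff ℂ (MatIdx m) m (partitionWeightLex m lam) := by
  classical
  refine le_antisymm (orbitMultiplicity_le_plethysmCoeff_holds _ (NeZero.ne m)
    (paddedPerFormLex_isHomogeneous ℂ hnm) _) ?_
  haveI : FiniteDimensional ℂ
      (highestWeightSpace (coordRep (MatIdx m) ℂ m) (partitionWeightLex m lam)) :=
    finiteDimensional_highestWeightSpace_coordRep_holds (NeZero.ne m) _
  -- the quotient map as an intertwining map out of `ℂ[Sym^m]`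
  let π : (coordRep (MatIdx m) ℂ m).IntertwiningMap (orbitCoordRep (paddedPerFormLex ℂ n m) m) :=
    ⟨(Ideal.Quotient.mkₐ ℂ (orbitVanishingIdeal (paddedPerFormLex ℂ n m) m)).toLinearMap,
      fun _ => LinearMap.ext fun _ => rfl⟩
  have hmap := map_highestWeightSpace_eq_of_surjective π (Ideal.Quotient.mkₐ_surjective ℂ _)
    (isSemisimpleRepresentation_coordRep m) (partitionWeightLex m lam)
  have hrn := LinearMap.finrank_range_add_finrank_ker (π.toLinearMap ∘ₗ
    (highestWeightSpace (coordRep (MatIdx m) ℂ m) (partitionWeightLex m lam)).subtype)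
  rw [LinearMap.range_comp, Submodule.range_subtype] at hrn
  -- the kernel is trivial: no small-body weight vector vanishes on `GL · X₀₀^{m-n} per_n`
  have hker : LinearMap.ker (π.toLinearMap ∘ₗ
      (highestWeightSpace (coordRep (MatIdx m) ℂ m) (partitionWeightLex m lam)).subtype) = ⊥ := by
    rw [LinearMap.ker_eq_bot']
    intro F hF0
    rw [LinearMap.comp_apply] at hF0
    have hFI : (F : MvPolynomial (DegIdx (MatIdx m) m) ℂ) ∈ orbitVanishingIdeal (paddedPerFormLex ℂ n m) m :=
      Ideal.Quotient.eq_zero_iff_mem.mp hF0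
    have hFw : (F : MvPolynomial (DegIdx (MatIdx m) m) ℂ) ∈
        weightSpace (coordRep (MatIdx m) ℂ m) (partitionWeightLex m lam) :=
      highestWeightSpace_le_weightSpace _ _ F.2
    have hzero := nsb_eq_zero_of_forall_body_le_of_testForms (δ := δ) (paddedPerFormLex ℂ n m) hnm
      (fun J a γ t ha hγ hJ => nsb_testForm_mem_orbitClosure_paddedPerFormLex hnm J a γ t ha hγ hJ)
      (F : MvPolynomial (DegIdx (MatIdx m) m) ℂ)
      (fun s hs => by
        have h := (nsb_body_eq_bodySize_of_mem_weightSpace lam hlam hFw (mem_support_iff.mpr hs)).1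
        rw [Finsupp.degree_eq_weight_one] at h
        exact h)
      (fun s hs => by
        rw [(nsb_body_eq_bodySize_of_mem_weightSpace lam hlam hFw hs).2]
        exact hbody)
      hFI
    exact Subtype.ext hzero
  rw [hker, finrank_bot, add_zero] at hrn
  unfold orbitMultiplicity plethysmCoeff hwMultiplicity
  rw [← hmap, hrn]

/-- **On the tiny-body range both sides are the plethysm coefficient**: for `n ≤ m` and
`bodySize λ ≤ n`, `mult_{λ*} ℂ[Δ_m(X₀₀^{m-n} per_n)] = K_m(λ*)` (`= a_λ(δ[m])`; the det side by
`noSmallBodyEquations`, body `≤ n ≤ m`). [folklore] -/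
theorem paddedPer_orbitMultiplicity_eq_det_of_bodySize_le_inner {n m δ : ℕ} [NeZero m]
    (hnm : n ≤ m) (lam : Nat.Partition (m * δ)) (hlam : lam.parts.card ≤ m * m) (hbody : bodySize lam ≤ n) :
    orbitMultiplicity ℂ (paddedPerFormLex ℂ n m) m (partitionWeightLex m lam) =
      orbitMultiplicity ℂ (detFormLex ℂ m) m (partitionWeightLex m lam) := by
  rw [paddedPer_orbitMultiplicity_eq_plethysmCoeff_of_bodySize_le_inner hnm lam hlam hbody,
    noSmallBodyEquations m δ lam hlam (hbody.trans hnm)]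

/-- The same in the crux's spelling of the weight. [folklore] -/
theorem paddedPer_orbitMultiplicity_eq_plethysmCoeff_of_bodySize_le_inner' {n m δ : ℕ} [NeZero m]
    (hnm : n ≤ m) (lam : Nat.Partition (m * δ)) (hlam : lam.parts.card ≤ m * m) (hbody : bodySize lam ≤ n) :
    orbitMultiplicity ℂ (paddedPerFormLex ℂ n m) m (Weight.dualOfPartition (m * m) lam).toMatIdx =
      plethysmCoeff ℂ (MatIdx m) m (Weight.dualOfPartition (m * m) lam).toMatIdx :=
  paddedPer_orbitMultiplicity_eq_plethysmCoeff_of_bodySize_le_inner hnm lam hlam hbody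

end Summit.ValiantsHypothesis.ValiantsHypothesis.Theorems.ValuativeFlip
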